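import Summits.ValiantsHypothesis.ValiantsHypothesis.Theorems.KPlusLogSqLawTropicalBMarkedEdgeCoreQS3
import Summits.ValiantsHypothesis.ValiantsHypothesis.Theorems.KPlusLogSqLawTropicalBMarkedEdgeExchangeFour

/-!
# Route «KPlusLogSqLaw», crux `TropicalB` (stmt-ValiantsHypothesis-19771) — MARKED-EDGE sector, NESTED-TRIANGLE CORE, ALL sizes:
# the KARAMATA STEP of the P-completion — `law_of_pcD_BC`, `law_of_pcD_BE` (a doubled-colour factorisation through the Q-cover kills the realisation)

HONEST FRAMING.  Helper file (cell `pub-symmetroid`, seat val-sym-trop-p4 (g19), 2026-08-29; `--supports stmt-ValiantsHypothesis-19771 --as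
helper`).  After `core_S3` (this seat, `…CoreQS3`: in every realisation a Q₁₈ ∈ σB⊎σC⊎σZ or a Q₂₀ ∈ σB⊎σE⊎σZ exists) the all-m
nested-triangle law is reduced to the P-COMPLETION.  LOCATED by this seat (memo S3STAR-PROOF-g19 §5; > 250 000 kernel-valid systems m ≤ 9 and g18's
corpora, 0 exceptions): the completion can always be taken of ONE uniform shape «PC-D» — a factorisation of the pair's union WITH ITS SECOND
COLOUR DOUBLED, `σB ⊎ σY ⊎ σY ⊎ σZ = Q ⊎ N₁ ⊎ N₂ ⊎ N₃` (`Y = C` resp. `E`), whose three remaining slopes `y₁ ≤ y₂ ≤ y₃` satisfy `y₃ ≥ 9` and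
`y₂ + y₃ ≥ 19` (resp. `≥ 21`); g18's 3-factor templates are the sub-case `N₃ = σY`.  THIS FILE proves the numerical half: such a factorisation
contradicts realisability (Abel/Karamata with the repeated parameter, `FourBit.four_factors_eq_le`, p655398-line).  The EXISTENCE of the
factorisation (PC-D) is OPEN (pair-local modulo the b4-rigidities; it is where the law now lives).  Nothing here proves the law; nothing concerns
`TropicalB` in its window, `WeakLifting`, the doors, `MatrixDescartes` (stmt-ValiantsHypothesis-18050) or VP ≠ VNP.
-/

set_option linter.dupNamespace false
set_option autoImplicit false

namespace Summit.ValiantsHypothesis.ValiantsHypothesis.Theorems.KPlusLogSqLaw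
namespace MarkedEdge
namespace Core

open Finset

variable {V : Type*} [Fintype V] [DecidableEq V]

section Core

variable (ok : V → V → Prop) (w g : V → V → ℤ) (b : Fin 5 → V)

/-- **Karamata step, pair (B,C).**  In a realisation, no factorisation `σB ⊎ σC ⊎ σC ⊎ σZ = Q ⊎ N₁ ⊎ N₂ ⊎ N₃` has `Q` of pattern ⊇ {b1,b4}∌b0
(slope ≥ 18, e.g. the Q₁₈ of `core_S3`) and remaining slopes with `9 ≤ s(N₃)` and `19 ≤ s(N₂) + s(N₃)`.  (Maximisers `(B,C,C,Z)` have slopes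
`(6,10,10,17)`; the factor slopes then dominate the suffix sums `17, 27, 37`, so `four_factors_eq_le` forces `Q = σZ`, absurd.)
[this seat's lemma] -/
theorem law_of_pcD_BC (hb : Function.Injective b)
    (hoff : ∀ i j, j ≠ i → g i j = 0) (hmark : ∀ l, g (b l) (b l) = (2 : ℤ) ^ (l : ℕ)) (haux : ∀ i, (∀ l, b l ≠ i) → g i i = 0)
    {θB θC θZ : ℤ} {σB σC σZ : Equiv.Perm V} (hBC : θB < θC) (hCZ : θC < θZ)
    (hB : (∀ i, ok i (σB i)) ∧ ∀ τ : Equiv.Perm V, τ ≠ σB → (∀ i, ok i (τ i)) →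
      ∑ i, (w i (τ i) + θB * g i (τ i)) < ∑ i, (w i (σB i) + θB * g i (σB i)))
    (hC : (∀ i, ok i (σC i)) ∧ ∀ τ : Equiv.Perm V, τ ≠ σC → (∀ i, ok i (τ i)) →
      ∑ i, (w i (τ i) + θC * g i (τ i)) < ∑ i, (w i (σC i) + θC * g i (σC i)))
    (hZ : (∀ i, ok i (σZ i)) ∧ ∀ τ : Equiv.Perm V, τ ≠ σZ → (∀ i, ok i (τ i)) →
      ∑ i, (w i (τ i) + θZ * g i (τ i)) < ∑ i, (w i (σZ i) + θZ * g i (σZ i)))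
    (hB0 : σB (b 0) ≠ b 0) (hB1 : σB (b 1) = b 1) (hB2 : σB (b 2) = b 2) (hB3 : σB (b 3) ≠ b 3) (hB4 : σB (b 4) ≠ b 4)
    (hC0 : σC (b 0) ≠ b 0) (hC1 : σC (b 1) = b 1) (hC2 : σC (b 2) ≠ b 2) (hC3 : σC (b 3) = b 3) (hC4 : σC (b 4) ≠ b 4)
    (hZ0 : σZ (b 0) = b 0) (hZ1 : σZ (b 1) ≠ b 1) (hZ2 : σZ (b 2) ≠ b 2) (hZ3 : σZ (b 3) ≠ b 3) (hZ4 : σZ (b 4) = b 4)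
    {Q N₁ N₂ N₃ : Equiv.Perm V} (hP : ∀ i, List.Perm [N₁ i, N₂ i, N₃ i, Q i] [σB i, σC i, σC i, σZ i])
    (hQ0 : Q (b 0) ≠ b 0) (hQ1 : Q (b 1) = b 1) (hQ4 : Q (b 4) = b 4)
    (h3 : 9 ≤ ∑ i, g i (N₃ i)) (h23 : 19 ≤ (∑ i, g i (N₂ i)) + ∑ i, g i (N₃ i)) : False := by
  have sB := slope_B g b hb hoff hmark haux σB hB0 hB1 hB2 hB3 hB4
  have sC := slope_C g b hb hoff hmark haux σC hC0 hC1 hC2 hC3 hC4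
  have sZ := slope_Z g b hb hoff hmark haux σZ hZ0 hZ1 hZ2 hZ3 hZ4
  have sQ : 18 ≤ ∑ i, g i (Q i) := by
    rw [slope_eq_sum_marked g b hb hoff hmark haux Q, Fin.sum_univ_five]
    by_cases c2 : Q (b 2) = b 2 <;> by_cases c3 : Q (b 3) = b 3 <;> simp [hQ0, hQ1, hQ4, c2, c3]
  have key := FourBit.four_factors_eq_le ok w g hBC.le le_rfl hCZ.le hB hC hC hZ hP
    (by rw [sZ]; omega) (by rw [sC, sZ]; omega) (by rw [sC, sZ]; omega)
  have hQZ : Q = σZ := key.2.2.2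
  exact hZ1 (by rw [← hQZ]; exact hQ1)

/-- **Karamata step, pair (B,E).**  Same with `σB ⊎ σE ⊎ σE ⊎ σZ` (slopes `(6,12,12,17)`, suffix sums `17, 29, 41`): a factorisation through a
`Q ∋` loops b2, b4, `∌` b0 with `9 ≤ s(N₃)`, `21 ≤ s(N₂) + s(N₃)` is impossible. [this seat's lemma] -/
theorem law_of_pcD_BE (hb : Function.Injective b)
    (hoff : ∀ i j, j ≠ i → g i j = 0) (hmark : ∀ l, g (b l) (b l) = (2 : ℤ) ^ (l : ℕ)) (haux : ∀ i, (∀ l, b l ≠ i) → g i i = 0)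
    {θB θE θZ : ℤ} {σB σE σZ : Equiv.Perm V} (hBE : θB < θE) (hEZ : θE < θZ)
    (hB : (∀ i, ok i (σB i)) ∧ ∀ τ : Equiv.Perm V, τ ≠ σB → (∀ i, ok i (τ i)) →
      ∑ i, (w i (τ i) + θB * g i (τ i)) < ∑ i, (w i (σB i) + θB * g i (σB i)))
    (hE : (∀ i, ok i (σE i)) ∧ ∀ τ : Equiv.Perm V, τ ≠ σE → (∀ i, ok i (τ i)) →
      ∑ i, (w i (τ i) + θE * g i (τ i)) < ∑ i, (w i (σE i) + θE * g i (σE i)))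
    (hZ : (∀ i, ok i (σZ i)) ∧ ∀ τ : Equiv.Perm V, τ ≠ σZ → (∀ i, ok i (τ i)) →
      ∑ i, (w i (τ i) + θZ * g i (τ i)) < ∑ i, (w i (σZ i) + θZ * g i (σZ i)))
    (hB0 : σB (b 0) ≠ b 0) (hB1 : σB (b 1) = b 1) (hB2 : σB (b 2) = b 2) (hB3 : σB (b 3) ≠ b 3) (hB4 : σB (b 4) ≠ b 4)
    (hE0 : σE (b 0) ≠ b 0) (hE1 : σE (b 1) ≠ b 1) (hE2 : σE (b 2) = b 2) (hE3 : σE (b 3) = b 3) (hE4 : σE (b 4) ≠ b 4)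
    (hZ0 : σZ (b 0) = b 0) (hZ1 : σZ (b 1) ≠ b 1) (hZ2 : σZ (b 2) ≠ b 2) (hZ3 : σZ (b 3) ≠ b 3) (hZ4 : σZ (b 4) = b 4)
    {Q N₁ N₂ N₃ : Equiv.Perm V} (hP : ∀ i, List.Perm [N₁ i, N₂ i, N₃ i, Q i] [σB i, σE i, σE i, σZ i])
    (hQ0 : Q (b 0) ≠ b 0) (hQ2 : Q (b 2) = b 2) (hQ4 : Q (b 4) = b 4)
    (h3 : 9 ≤ ∑ i, g i (N₃ i)) (h23 : 21 ≤ (∑ i, g i (N₂ i)) + ∑ i, g i (N₃ i)) : False := by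
  have sB := slope_B g b hb hoff hmark haux σB hB0 hB1 hB2 hB3 hB4
  have sE := slope_E g b hb hoff hmark haux σE hE0 hE1 hE2 hE3 hE4
  have sZ := slope_Z g b hb hoff hmark haux σZ hZ0 hZ1 hZ2 hZ3 hZ4
  have sQ : 20 ≤ ∑ i, g i (Q i) := by
    rw [slope_eq_sum_marked g b hb hoff hmark haux Q, Fin.sum_univ_five]
    by_cases c1 : Q (b 1) = b 1 <;> by_cases c3 : Q (b 3) = b 3 <;> simp [hQ0, hQ2, hQ4, c1, c3]
  have key := FourBit.four_factors_eq_le ok w g hBE.le le_rfl hEZ.le hB hE hE hZ hP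
    (by rw [sZ]; omega) (by rw [sE, sZ]; omega) (by rw [sE, sZ]; omega)
  have hQZ : Q = σZ := key.2.2.2
  exact hZ2 (by rw [← hQZ]; exact hQ2)

end Core

end Core
end MarkedEdge
end Summit.ValiantsHypothesis.ValiantsHypothesis.Theorems.KPlusLogSqLaw
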